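import Literature.NumberTheory.ComplexMultiplication.EllipticUnits.KatoLayerArtinCompatibility
import Literature.NumberTheory.EllipticCurves.DeShalit1987.RayClassTower
import Literature.NumberTheory.EllipticCurves.ZpExtensionUnramifiedProofs
import HarnessLib

/-!
# The `(γ₁, γ₂)`-exponents of `σ_𝔞 = (𝔞, K̃_∞/K)` along Kato's tower — the Artin half (A1) of
# Johnson-Leung–Kings' pinned datum `TwistedIwasawaData`, SUPPLIED (no named fact), and its
# non-vacuity over totally complex `K`

Topic `NumberTheory/ComplexMultiplication/EllipticUnits`; namespace
`Literature.NumberTheory.ComplexMultiplication.EllipticUnits` (grouping sub-namespace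
`JohnsonLeungKings2011`). Cell `bsd-print-cf2` (`run/shared/lean/pub/bsd-print-cf2/`), width seat
`bsd-line-cf2-p1-w2` g17, `--supports` the deciding child stmt-BirchSwinnertonDyer-24721 of crux 20368.
THEOREMS ONLY (no `def`, no named fact, no `sorry`). Sequel of `KatoLayerArtinCompatibility.lean`
(compatibility `(layerArtin p 𝔣 s 𝔞)⁻¹ · layerArtin p 𝔣 s′ 𝔞 ∈ Gal(K̄/K(p^s𝔣))`).

Johnson-Leung–Kings 2011 §5.1: "`σ_𝔞 := (𝔞, K_∞/K)`"; with a topological basis `(γ₁, γ₂)` of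
`Gal(K_∞/K) ≅ ℤ_p²`, `σ_𝔞 = γ₁^{x₁} γ₂^{x₂}`, `x_i ∈ ℤ_p`. The tree's `TwistedIwasawaData` (file
`ImaginaryQuadraticMainConjectureCarriers.lean`) pins the exponents by the clause (A1) `artin_spec`:
`∀ 𝔞 n, ∃ s₀, ∀ s ≥ s₀, Gal(K̄/K(p^s𝔣)) ≤ Gal(K̄/K̃_n) → γ₁^{x₁ mod pⁿ} γ₂^{x₂ mod pⁿ} (layerArtin p 𝔣 s 𝔞)⁻¹
∈ Gal(K̄/K̃_n)`. This file constructs such exponents: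

* §3 a `ℤ_p`-LIMIT LEMMA: `exists_padicInt_toZModPow_eq` (compatible residues come from a `p`-adic
  integer; Mathlib `PadicInt.lift` on `ℤ[X]`) and `exists_padicInt_forall_dvd_sub_of_compatible` (a
  sequence eventually compatible modulo `pⁿ` along "fine enough" levels has a `p`-adic limit along them;
  levels at which no index is fine enough are vacuous); then `prime_pow_dvd_apply_layerArtin_sub` (the
  `κ`-values of Kato's lifts are compatible) and THE (A1) SUPPLIER
  **`JohnsonLeungKings2011.exists_artin_exponents`** (at a `ZpExtension.IsTopGeneratorPair`),
  **`…_inv`** (at the inverse pair `(γ₁⁻¹, γ₂⁻¹)`, the pair of the cell's dock), both special cases of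
  **`exists_artin_exponents_of_units`** (any pair on which `(κ₁, κ₂)` is diagonal with unit entries):
  the conclusion is `artin_spec` VERBATIM, hypothesis `𝔣 ≠ 0` only;
* §4 NON-VACUITY for totally complex `K`: **`exists_katoLevelSubgroup_le_pairLayerSubgroup`**
  `∀ n ∃ s, Gal(K̄/K(p^s𝔣)) ≤ Gal(K̄/K̃_n)` — the generators of de Shalit's `rayKer K p ∅` (commutators,
  inertia away from `p`) die in every layer group (`ℤ_p` abelian; the tree's PROVED
  `ZpExtension.inertia_le_kerSubgroup_holds` = Washington Prop. 13.2), so the open layer group contains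
  some `Gal(K̄/C_{(p)^m})` (the tree's `DeShalit1987.exists_ker_absRestrictNormalHom_rayClassField_le_of_
  rayKer_le`, Neukirch VI (6.6)) and `C_{(p)^m} ⊆ K(p^m𝔣)`; and the combined
  **`exists_artin_exponents_and_level`**.

HONEST FRAMING: the Artin half of JLK's datum only; the UNIT half (Kato's elliptic units `_𝔞θ_E(α)`,
the pins (Z1)/(Z2)) is untouched; nothing here is about an elliptic curve; BSD is not advanced.

## References
* [JohnsonLeungKings2011] J. Johnson-Leung, G. Kings, J. reine angew. Math. 653 (2011), §5.1
  (arXiv:0804.2828 p0014:L12–14: "`σ_𝔞 := (𝔞, K_∞/K)`"), §4.1 (p0012:L7–14: the layers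
  `K ⊂ K_n ⊂ K_∞`, `Gal(K_n/K) ≅ (ℤ/pⁿ)²`).
* [Kato2004Asterisque] K. Kato, Astérisque 295 (2004), §15.6 (p. 254: "`(𝔞, K(p^∞𝔣)/K) ∈ G_{p^∞𝔣}`").
* [Washington1997] L. Washington, *Introduction to Cyclotomic Fields*, 2nd ed. (1997), §13.1
  (`ℤ_p`-extensions, `ℤ_p = lim← ℤ/pⁿ`), Prop. 13.2 (unramified outside `p`).
* [NeukirchANT1999] J. Neukirch, *Algebraic Number Theory* (1999), Ch. VI §6 Def. (6.2), Cor. (6.6).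
* [deShalit1987] E. de Shalit, *Iwasawa theory of elliptic curves with complex multiplication* (1987),
  II.4.12 Remark (i) (p. 67).
-/

noncomputable section

open scoped Classical
open Field NumberField IsDedekindDomain
open Literature.NumberTheory.NumberFields (rayClassField rayUnitIdeles mem_rayUnitIdeles_iff rayClassField_mono)
open Literature.NumberTheory.GaloisRepresentations
open Literature.NumberTheory.EllipticCurves

namespace Literature.NumberTheory.ComplexMultiplication.EllipticUnits

variable {K : Type} [Field K] [NumberField K] (p : ℕ) (𝔣 : Ideal (𝓞 K))

/-! ## §3. `p`-adic limits of compatible residues, and the `(γ₁, γ₂)`-exponents of `σ_𝔞` (the pin (A1)) -/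

section PadicLimit

variable [Fact p.Prime]

omit [NumberField K] in
/-- **A compatible system of residues `c_n ∈ ℤ/pⁿ` is the system of residues of a `p`-adic integer**
(`ℤ_p = lim← ℤ/pⁿ`; Mathlib's `PadicInt.lift` applied on `ℤ[X]`, `X ↦ c_n`).
[cite: Washington1997, §13.1] -/
theorem exists_padicInt_toZModPow_eq (c : ∀ n : ℕ, ZMod (p ^ n))
    (hc : ∀ (n m : ℕ) (h : n ≤ m), ZMod.castHom (pow_dvd_pow p h) (ZMod (p ^ n)) (c m) = c n) :
    ∃ x : ℤ_[p], ∀ n, PadicInt.toZModPow n x = c n := by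
  let f : ∀ m : ℕ, Polynomial ℤ →+* ZMod (p ^ m) := fun m ↦
    Polynomial.eval₂RingHom (Int.castRingHom (ZMod (p ^ m))) (c m)
  have hfX : ∀ m, f m Polynomial.X = c m := fun m ↦ Polynomial.eval₂_X _ _
  have hfcompat : ∀ (k1 k2 : ℕ) (hk : k1 ≤ k2),
      (ZMod.castHom (pow_dvd_pow p hk) (ZMod (p ^ k1))).comp (f k2) = f k1 := by
    intro k1 k2 hk
    refine Polynomial.ringHom_ext (fun a ↦ by simp [f]) ?_
    rw [RingHom.comp_apply, hfX, hfX, hc k1 k2 hk]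
  refine ⟨PadicInt.lift hfcompat Polynomial.X, fun n ↦ ?_⟩
  have h := DFunLike.congr_fun (PadicInt.lift_spec hfcompat n) Polynomial.X
  rw [RingHom.comp_apply] at h
  rw [h, hfX]

omit [NumberField K] in
/-- `pⁿ ∣ (x mod pⁿ, read back in ℤ_p as a natural number) − x`. [cite: Washington1997, §13.1] -/
theorem prime_pow_dvd_natCast_toZModPow_val_sub (n : ℕ) (x : ℤ_[p]) :
    (p : ℤ_[p]) ^ n ∣ ((PadicInt.toZModPow n x).val : ℤ_[p]) - x := by
  rw [← Ideal.mem_span_singleton, ← PadicInt.ker_toZModPow, RingHom.sub_mem_ker_iff, map_natCast,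
    ZMod.natCast_zmod_val]

omit [NumberField K] in
/-- `pⁿ ∣ a − b` iff `a` and `b` have the same residue mod `pⁿ`. [cite: Washington1997, §13.1] -/
theorem prime_pow_dvd_sub_iff_toZModPow_eq (n : ℕ) (a b : ℤ_[p]) :
    (p : ℤ_[p]) ^ n ∣ a - b ↔ PadicInt.toZModPow n a = PadicInt.toZModPow n b := by
  rw [← Ideal.mem_span_singleton, ← PadicInt.ker_toZModPow, RingHom.sub_mem_ker_iff]

omit [NumberField K] in
/-- **`p`-ADIC LIMIT ALONG AN EVENTUALLY COMPATIBLE SEQUENCE.** Let `P n s` ("level `s` is fine enough for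
precision `pⁿ`") be antitone in `n`, and `y : ℕ → ℤ_p` satisfy `pⁿ ∣ y s − y s₁` whenever `P n s₁` and
`s₁ ≤ s`. Then some `x ∈ ℤ_p` has `pⁿ ∣ x − y s` for all large `s` with `P n s`, for EVERY `n` (levels `n`
at which no `s` is fine enough are vacuous; if every `n` admits one, `x = lim_s y s`).
[cite: Washington1997, §13.1] -/
theorem exists_padicInt_forall_dvd_sub_of_compatible (P : ℕ → ℕ → Prop)
    (hPn : ∀ n m s, n ≤ m → P m s → P n s) (y : ℕ → ℤ_[p])
    (hy : ∀ n s₁ s, P n s₁ → s₁ ≤ s → (p : ℤ_[p]) ^ n ∣ y s - y s₁) :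
    ∃ x : ℤ_[p], ∀ n, ∃ s₀, ∀ s, s₀ ≤ s → P n s → (p : ℤ_[p]) ^ n ∣ x - y s := by
  by_cases hall : ∀ n, ∃ s, P n s
  · -- every precision is reached: `x = lim y (t n)`, `t n` the least fine-enough level
    let t : ℕ → ℕ := fun n ↦ Nat.find (hall n)
    have ht : ∀ n, P n (t n) := fun n ↦ Nat.find_spec (hall n)
    have htmono : ∀ n m, n ≤ m → t n ≤ t m := fun n m h ↦
      Nat.find_min' (hall n) (hPn n m _ h (ht m))
    obtain ⟨x, hx⟩ := exists_padicInt_toZModPow_eq p (fun n ↦ PadicInt.toZModPow n (y (t n)))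
      (fun n m h ↦ by
        rw [ZMod.castHom_apply, PadicInt.cast_toZModPow n m h,
          ← prime_pow_dvd_sub_iff_toZModPow_eq]
        exact hy n (t n) (t m) (ht n) (htmono n m h))
    refine ⟨x, fun n ↦ ⟨t n, fun s hs _ ↦ ?_⟩⟩
    have h1 : (p : ℤ_[p]) ^ n ∣ x - y (t n) := (prime_pow_dvd_sub_iff_toZModPow_eq p n _ _).mpr (hx n)
    have h2 := hy n (t n) s (ht n) hs
    have e : x - y s = (x - y (t n)) - (y s - y (t n)) := by ring
    rw [e]
    exact dvd_sub h1 h2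
  · -- some precision is never reached: the claim is vacuous from the least such `N` on
    push Not at hall
    let N : ℕ := Nat.find hall
    have hN : ∀ s, ¬ P N s := Nat.find_spec hall
    have hvac : ∀ n, N ≤ n → ∀ s, ¬ P n s := fun n hn s h ↦ hN s (hPn N n s hn h)
    rcases Nat.eq_zero_or_eq_succ_pred N with h0 | hsucc
    · exact ⟨0, fun n ↦ ⟨0, fun s _ hP ↦ (hvac n (h0 ▸ Nat.zero_le n) s hP).elim⟩⟩
    · have hk : ∃ s, P (N - 1) s := by
        have := Nat.find_min hall (m := N - 1) (by omega)
        push Not at this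
        exact this
      obtain ⟨t, ht⟩ := hk
      refine ⟨y t, fun n ↦ ⟨t, fun s hs hP ↦ ?_⟩⟩
      by_cases hn : n ≤ N - 1
      · have h2 := hy n t s (hPn n (N - 1) t hn ht) hs
        have e : y t - y s = -(y s - y t) := by ring
        rw [e]
        exact (dvd_neg).mpr h2
      · exact (hvac n (by omega) s hP).elim

end PadicLimit

namespace JohnsonLeungKings2011

variable [Fact p.Prime] {p 𝔣}

/-- Through a continuous character `κ : Γ_K → ℤ_p` whose `n`-th layer group contains `Gal(K̄/K̃_n)`, Kato's
lifted Artin symbols have compatible values: `pⁿ ∣ κ(layerArtin s 𝔞) − κ(layerArtin s₁ 𝔞)` for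
`s₁ ≤ s` once `K̃_n ⊆ K(p^{s₁}𝔣)`. [cite: JohnsonLeungKings2011, §5.1 (arXiv p0014:L12–14)]
[cite: Kato2004Asterisque, §15.6 (p. 254)] -/
theorem prime_pow_dvd_apply_layerArtin_sub (h𝔣 : 𝔣 ≠ ⊥) (κ κ₁ κ₂ : ZpExtension K p)
    (hκ : ∀ n, pairLayerSubgroup κ₁ κ₂ n ≤ κ.layerSubgroup n) (a : AuxIdeals p 𝔣) {n s₁ s : ℕ}
    (hP : katoLevelSubgroup p 𝔣 s₁ ≤ pairLayerSubgroup κ₁ κ₂ n) (hs : s₁ ≤ s) :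
    (p : ℤ_[p]) ^ n ∣ (κ (layerArtin p 𝔣 s a.1)).toAdd - (κ (layerArtin p 𝔣 s₁ a.1)).toAdd := by
  have hmem : (layerArtin p 𝔣 s₁ a.1)⁻¹ * layerArtin p 𝔣 s a.1 ∈ κ.layerSubgroup n :=
    hκ n (hP (layerArtin_inv_mul_layerArtin_mem_of_isTwist hs h𝔣 a.2))
  rw [ZpExtension.mem_layerSubgroup, map_mul κ, map_inv κ, toAdd_mul, toAdd_inv] at hmem
  have e : (κ (layerArtin p 𝔣 s a.1)).toAdd - (κ (layerArtin p 𝔣 s₁ a.1)).toAdd =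
      -(κ (layerArtin p 𝔣 s₁ a.1)).toAdd + (κ (layerArtin p 𝔣 s a.1)).toAdd := by ring
  rwa [e]

/-- **The `p`-adic coordinate of `σ_𝔞 = (𝔞, K̃_∞/K)` along `κ`**: a `p`-adic integer `x` with
`pⁿ ∣ x − κ(layerArtin s 𝔞)` for all large `s` with `K̃_n ⊆ K(p^s𝔣)` — the limit of the `κ`-values of
Kato's lifts. [cite: JohnsonLeungKings2011, §5.1 (arXiv p0014:L12–14)] [cite: Kato2004Asterisque, §15.6 (p. 254)] -/
theorem exists_padicInt_forall_dvd_sub_apply_layerArtin (h𝔣 : 𝔣 ≠ ⊥) (κ κ₁ κ₂ : ZpExtension K p)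
    (hκ : ∀ n, pairLayerSubgroup κ₁ κ₂ n ≤ κ.layerSubgroup n) (a : AuxIdeals p 𝔣) :
    ∃ x : ℤ_[p], ∀ n, ∃ s₀, ∀ s, s₀ ≤ s → katoLevelSubgroup p 𝔣 s ≤ pairLayerSubgroup κ₁ κ₂ n →
      (p : ℤ_[p]) ^ n ∣ x - (κ (layerArtin p 𝔣 s a.1)).toAdd :=
  exists_padicInt_forall_dvd_sub_of_compatible p
    (fun n s ↦ katoLevelSubgroup p 𝔣 s ≤ pairLayerSubgroup κ₁ κ₂ n)
    (fun _ _ _ h hP ↦ hP.trans (pairLayerSubgroup_antitone κ₁ κ₂ h))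
    (fun s ↦ (κ (layerArtin p 𝔣 s a.1)).toAdd)
    (fun _ _ _ hP hs ↦ prime_pow_dvd_apply_layerArtin_sub h𝔣 κ κ₁ κ₂ hκ a hP hs)

/-- **THE PIN (A1) SUPPLIED for any pair `(δ₁, δ₂)` on which `(κ₁, κ₂)` is diagonal with UNIT entries**
(`κ₁(δ₁) = u₁`, `κ₂(δ₁) = 0`, `κ₁(δ₂) = 0`, `κ₂(δ₂) = u₂`, additive notation): there are exponent maps
`x₁, x₂ : 𝔞 ↦ ℤ_p` with `δ₁^{x₁ mod pⁿ} δ₂^{x₂ mod pⁿ} (layerArtin p 𝔣 s 𝔞)⁻¹ ∈ Gal(K̄/K̃_n)` for all large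
`s` with `K̃_n ⊆ K(p^s𝔣)` — `σ_𝔞 = δ₁^{x₁} δ₂^{x₂}` in `Gal(K̃_∞/K)`.
[cite: JohnsonLeungKings2011, §5.1 (arXiv p0014:L12–14)] [cite: Kato2004Asterisque, §15.6 (p. 254)] -/
theorem exists_artin_exponents_of_units (h𝔣 : 𝔣 ≠ ⊥) (κ₁ κ₂ : ZpExtension K p)
    (δ₁ δ₂ : absoluteGaloisGroup K) (u₁ u₂ : ℤ_[p]ˣ)
    (h₁₁ : κ₁ δ₁ = Multiplicative.ofAdd (u₁ : ℤ_[p])) (h₂₁ : κ₂ δ₁ = 1) (h₁₂ : κ₁ δ₂ = 1)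
    (h₂₂ : κ₂ δ₂ = Multiplicative.ofAdd (u₂ : ℤ_[p])) :
    ∃ artin₁ artin₂ : AuxIdeals p 𝔣 → ℤ_[p], ∀ (a : AuxIdeals p 𝔣) (n : ℕ), ∃ s₀ : ℕ, ∀ s : ℕ, s₀ ≤ s →
      katoLevelSubgroup p 𝔣 s ≤ pairLayerSubgroup κ₁ κ₂ n →
        δ₁ ^ (PadicInt.toZModPow n (artin₁ a)).val * δ₂ ^ (PadicInt.toZModPow n (artin₂ a)).val *
            (layerArtin p 𝔣 s a.1)⁻¹ ∈ pairLayerSubgroup κ₁ κ₂ n := by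
  have hle₁ : ∀ n, pairLayerSubgroup κ₁ κ₂ n ≤ κ₁.layerSubgroup n := fun n ↦ inf_le_left
  have hle₂ : ∀ n, pairLayerSubgroup κ₁ κ₂ n ≤ κ₂.layerSubgroup n := fun n ↦ inf_le_right
  choose L₁ hL₁ using fun a ↦ exists_padicInt_forall_dvd_sub_apply_layerArtin h𝔣 κ₁ κ₁ κ₂ hle₁ a
  choose L₂ hL₂ using fun a ↦ exists_padicInt_forall_dvd_sub_apply_layerArtin h𝔣 κ₂ κ₁ κ₂ hle₂ a
  refine ⟨fun a ↦ ((u₁⁻¹ : ℤ_[p]ˣ) : ℤ_[p]) * L₁ a, fun a ↦ ((u₂⁻¹ : ℤ_[p]ˣ) : ℤ_[p]) * L₂ a,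
    fun a n ↦ ?_⟩
  beta_reduce
  obtain ⟨s₁, hs₁⟩ := hL₁ a n
  obtain ⟨s₂, hs₂⟩ := hL₂ a n
  refine ⟨max s₁ s₂, fun s hs hP ↦ ?_⟩
  have d₁ := hs₁ s ((le_max_left _ _).trans hs) hP
  have d₂ := hs₂ s ((le_max_right _ _).trans hs) hP
  have e₁ := prime_pow_dvd_natCast_toZModPow_val_sub p n (((u₁⁻¹ : ℤ_[p]ˣ) : ℤ_[p]) * L₁ a)
  have e₂ := prime_pow_dvd_natCast_toZModPow_val_sub p n (((u₂⁻¹ : ℤ_[p]ˣ) : ℤ_[p]) * L₂ a)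
  refine Subgroup.mem_inf.mpr ⟨?_, ?_⟩
  · rw [ZpExtension.mem_layerSubgroup, map_mul κ₁, map_mul κ₁, map_pow κ₁, map_pow κ₁, map_inv κ₁, h₁₁, h₁₂,
      toAdd_mul, toAdd_mul, toAdd_inv, toAdd_pow, toAdd_pow, toAdd_ofAdd, toAdd_one, smul_zero,
      add_zero, nsmul_eq_mul]
    have e : ((PadicInt.toZModPow n (((u₁⁻¹ : ℤ_[p]ˣ) : ℤ_[p]) * L₁ a)).val : ℤ_[p]) * (u₁ : ℤ_[p]) +
        -(κ₁ (layerArtin p 𝔣 s a.1)).toAdd =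
        (u₁ : ℤ_[p]) * (((PadicInt.toZModPow n (((u₁⁻¹ : ℤ_[p]ˣ) : ℤ_[p]) * L₁ a)).val : ℤ_[p]) -
          ((u₁⁻¹ : ℤ_[p]ˣ) : ℤ_[p]) * L₁ a) + (L₁ a - (κ₁ (layerArtin p 𝔣 s a.1)).toAdd) := by
      rw [mul_sub, ← mul_assoc, Units.mul_inv, one_mul]
      ring
    rw [e]
    exact dvd_add (dvd_mul_of_dvd_right e₁ _) d₁
  · rw [ZpExtension.mem_layerSubgroup, map_mul κ₂, map_mul κ₂, map_pow κ₂, map_pow κ₂, map_inv κ₂, h₂₁, h₂₂,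
      toAdd_mul, toAdd_mul, toAdd_inv, toAdd_pow, toAdd_pow, toAdd_ofAdd, toAdd_one, smul_zero,
      zero_add, nsmul_eq_mul]
    have e : ((PadicInt.toZModPow n (((u₂⁻¹ : ℤ_[p]ˣ) : ℤ_[p]) * L₂ a)).val : ℤ_[p]) * (u₂ : ℤ_[p]) +
        -(κ₂ (layerArtin p 𝔣 s a.1)).toAdd =
        (u₂ : ℤ_[p]) * (((PadicInt.toZModPow n (((u₂⁻¹ : ℤ_[p]ˣ) : ℤ_[p]) * L₂ a)).val : ℤ_[p]) -
          ((u₂⁻¹ : ℤ_[p]ˣ) : ℤ_[p]) * L₂ a) + (L₂ a - (κ₂ (layerArtin p 𝔣 s a.1)).toAdd) := by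
      rw [mul_sub, ← mul_assoc, Units.mul_inv, one_mul]
      ring
    rw [e]
    exact dvd_add (dvd_mul_of_dvd_right e₂ _) d₂

/-- **THE PIN (A1) OF `TwistedIwasawaData` SUPPLIED at a topological generator pair `(κ₁, κ₂; γ₁, γ₂)`**:
there are `artin₁ artin₂ : AuxIdeals p 𝔣 → ℤ_p` with, for every `𝔞` and `n`, for all large `s` with
`Gal(K̄/K(p^s𝔣)) ≤ Gal(K̄/K̃_n)`: `γ₁^{x₁ mod pⁿ} γ₂^{x₂ mod pⁿ} (layerArtin p 𝔣 s 𝔞)⁻¹ ∈ Gal(K̄/K̃_n)` —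
the field `artin_spec` VERBATIM ("`σ_𝔞 := (𝔞, K_∞/K) = γ₁^{x₁}γ₂^{x₂}`"). No hypothesis on `K`.
[cite: JohnsonLeungKings2011, §5.1 (arXiv p0014:L12–14)] [cite: Kato2004Asterisque, §15.6 (p. 254)] -/
theorem exists_artin_exponents (h𝔣 : 𝔣 ≠ ⊥) {κ₁ κ₂ : ZpExtension K p} {γ₁ γ₂ : absoluteGaloisGroup K}
    (hγ : ZpExtension.IsTopGeneratorPair κ₁ κ₂ γ₁ γ₂) :
    ∃ artin₁ artin₂ : AuxIdeals p 𝔣 → ℤ_[p], ∀ (a : AuxIdeals p 𝔣) (n : ℕ), ∃ s₀ : ℕ, ∀ s : ℕ, s₀ ≤ s →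
      katoLevelSubgroup p 𝔣 s ≤ pairLayerSubgroup κ₁ κ₂ n →
        γ₁ ^ (PadicInt.toZModPow n (artin₁ a)).val * γ₂ ^ (PadicInt.toZModPow n (artin₂ a)).val *
            (layerArtin p 𝔣 s a.1)⁻¹ ∈ pairLayerSubgroup κ₁ κ₂ n :=
  exists_artin_exponents_of_units h𝔣 κ₁ κ₂ γ₁ γ₂ 1 1 (by rw [Units.val_one]; exact hγ.left)
    hγ.apply_left hγ.apply_right (by rw [Units.val_one]; exact hγ.right)

/-- **THE PIN (A1) at the INVERSE pair `(γ₁⁻¹, γ₂⁻¹)`** — the pair at which the cell's dock instantiates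
`TwistedIwasawaData 2 κ₁ κ₂ γ₁⁻¹ γ₂⁻¹ θ 𝔣 ι` (the facts take a generator pair up to units).
[cite: JohnsonLeungKings2011, §5.1 (arXiv p0014:L12–14)] [cite: Kato2004Asterisque, §15.6 (p. 254)] -/
theorem exists_artin_exponents_inv (h𝔣 : 𝔣 ≠ ⊥) {κ₁ κ₂ : ZpExtension K p} {γ₁ γ₂ : absoluteGaloisGroup K}
    (hγ : ZpExtension.IsTopGeneratorPair κ₁ κ₂ γ₁ γ₂) :
    ∃ artin₁ artin₂ : AuxIdeals p 𝔣 → ℤ_[p], ∀ (a : AuxIdeals p 𝔣) (n : ℕ), ∃ s₀ : ℕ, ∀ s : ℕ, s₀ ≤ s →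
      katoLevelSubgroup p 𝔣 s ≤ pairLayerSubgroup κ₁ κ₂ n →
        γ₁⁻¹ ^ (PadicInt.toZModPow n (artin₁ a)).val * γ₂⁻¹ ^ (PadicInt.toZModPow n (artin₂ a)).val *
            (layerArtin p 𝔣 s a.1)⁻¹ ∈ pairLayerSubgroup κ₁ κ₂ n :=
  exists_artin_exponents_of_units h𝔣 κ₁ κ₂ γ₁⁻¹ γ₂⁻¹ (-1) (-1)
    (by rw [map_inv κ₁, show κ₁ γ₁ = Multiplicative.ofAdd 1 from hγ.left, Units.val_neg, Units.val_one,
      ofAdd_neg])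
    (by rw [map_inv κ₂, hγ.apply_left, inv_one]) (by rw [map_inv κ₁, hγ.apply_right, inv_one])
    (by rw [map_inv κ₂, show κ₂ γ₂ = Multiplicative.ofAdd 1 from hγ.right, Units.val_neg, Units.val_one,
      ofAdd_neg])

end JohnsonLeungKings2011

/-! ## §4. Totally complex `K`: every layer `K̃_n` lies in some `K(p^s𝔣)` (the pin is never vacuous) -/

namespace JohnsonLeungKings2011

variable [Fact p.Prime] {p}

omit [NumberField K] in
/-- The commutator subgroup of `Γ_K` lies in every layer group `κ⁻¹(pⁿℤ_p)` (`ℤ_p` is abelian).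
[cite: Washington1997, §13.1] -/
theorem commutator_le_layerSubgroup (κ : ZpExtension K p) (n : ℕ) :
    commutator (absoluteGaloisGroup K) ≤ κ.layerSubgroup n := by
  intro g hg
  have h1 : g ∈ (κ.toContinuousMonoidHom.toMonoidHom).ker := Abelianization.commutator_subset_ker _ hg
  rw [MonoidHom.mem_ker] at h1
  rw [ZpExtension.mem_layerSubgroup, show κ g = 1 from h1, toAdd_one]
  exact dvd_zero _

/-- **The generators of `Gal(K̄/K(p^∞))` — commutators and the inertia groups away from `p` — lie in every
layer group `Gal(K̄/K̃_n)` of a pair of `ℤ_p`-extensions** (a `ℤ_p`-extension is abelian and unramified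
outside `p`: the tree's PROVED `ZpExtension.inertia_le_kerSubgroup_holds`, Washington Prop. 13.2).
[cite: Washington1997, §13.1, Prop. 13.2] -/
theorem rayKer_le_pairLayerSubgroup (κ₁ κ₂ : ZpExtension K p) (n : ℕ) :
    DeShalit1987.rayKer K p ∅ ≤ pairLayerSubgroup κ₁ κ₂ n := by
  refine Subgroup.topologicalClosure_minimal _ (Subgroup.normalClosure_le_normal ?_) ?_
  · intro τ hτ
    rcases DeShalit1987.mem_rayGenerators_iff.mp hτ with hτ | ⟨w, -, hwp, 𝔓, h𝔓, hτ⟩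
    · exact ⟨commutator_le_layerSubgroup κ₁ n hτ, commutator_le_layerSubgroup κ₂ n hτ⟩
    · exact ⟨κ₁.kerSubgroup_le_layerSubgroup n
          (ZpExtension.inertia_le_kerSubgroup_holds K p κ₁ hwp h𝔓 hτ),
        κ₂.kerSubgroup_le_layerSubgroup n
          (ZpExtension.inertia_le_kerSubgroup_holds K p κ₂ hwp h𝔓 hτ)⟩
  · exact Subgroup.isClosed_of_isOpen _ (isOpen_pairLayerSubgroup κ₁ κ₂ n)

omit [Fact p.Prime] in
/-- `p^m𝔣 ⊆ 𝔪_∅^m = (p)^m` (de Shalit's modulus with empty tame set).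
[cite: deShalit1987, II.4.12 Remark (i) (p. 67)] -/
theorem katoModulus_le_rayModulus_empty_pow (m : ℕ) :
    katoModulus p 𝔣 m ≤ DeShalit1987.rayModulus K p ∅ ^ m := by
  rw [DeShalit1987.rayModulus, Finset.prod_empty, mul_one]
  exact katoModulus_le_span_pow p 𝔣 m

/-- `C_{(p)^m} ⊆ K(p^m𝔣)`, hence `Gal(K̄/K(p^m𝔣)) ≤ Gal(K̄/C_{(p)^m})`.
[cite: NeukirchANT1999, Ch. VI §6 Def. (6.2)] [cite: Kato2004Asterisque, §15.1 (p. 250)] -/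
theorem katoLevelSubgroup_le_ker_absRestrictNormalHom_rayClassField (h𝔣 : 𝔣 ≠ ⊥) (m : ℕ) :
    katoLevelSubgroup p 𝔣 m ≤
      (absRestrictNormalHom (rayClassField K (DeShalit1987.rayModulus K p ∅ ^ m))).ker := by
  have hle : rayClassField K (DeShalit1987.rayModulus K p ∅ ^ m) ≤ katoLayer p 𝔣 m :=
    rayClassField_mono (rayUnitIdeles_anti_of_le (katoModulus_ne_bot p 𝔣 h𝔣 m)
      (katoModulus_le_rayModulus_empty_pow 𝔣 m))
  intro σ hσ
  change σ ∈ absGaloisFixingSubgroup _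
  rw [mem_absGaloisFixingSubgroup_iff] at hσ ⊢
  exact fun x hx ↦ hσ x (hle hx)

/-- **For totally complex `K`, every layer `K̃_n` of a pair of `ℤ_p`-extensions lies in some `K(p^s𝔣)`:
`∃ s, Gal(K̄/K(p^s𝔣)) ≤ Gal(K̄/K̃_n)`** — `K̃_n/K` is finite abelian and unramified outside `p`, so its
conductor divides a power of `(p)` (Neukirch VI (6.6); no archimedean condition since `K` has no real
place) and `K̃_n ⊆ C_{(p)^s} ⊆ K(p^s𝔣)`. So the pin (A1) is NEVER vacuous over an imaginary quadratic `K`.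
[cite: NeukirchANT1999, Ch. VI §6 Cor. (6.6)] [cite: JohnsonLeungKings2011, §4.1 (arXiv p0012:L7–14)]
[cite: Washington1997, Prop. 13.2] -/
theorem exists_katoLevelSubgroup_le_pairLayerSubgroup [IsTotallyComplex K] (h𝔣 : 𝔣 ≠ ⊥)
    (κ₁ κ₂ : ZpExtension K p) (n : ℕ) :
    ∃ s : ℕ, katoLevelSubgroup p 𝔣 s ≤ pairLayerSubgroup κ₁ κ₂ n := by
  obtain ⟨m, -, hm⟩ := DeShalit1987.exists_ker_absRestrictNormalHom_rayClassField_le_of_rayKer_le p ∅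
    (isOpen_pairLayerSubgroup κ₁ κ₂ n) (rayKer_le_pairLayerSubgroup κ₁ κ₂ n)
  exact ⟨m, (katoLevelSubgroup_le_ker_absRestrictNormalHom_rayClassField 𝔣 h𝔣 m).trans hm⟩

/-- **(A1) with a UNIFORM witness over totally complex `K`**: at a topological generator pair there are
exponent maps `artin₁ artin₂` such that for every `𝔞` and `n` SOME level `s` has BOTH `K̃_n ⊆ K(p^s𝔣)`
and `γ₁^{x₁ mod pⁿ} γ₂^{x₂ mod pⁿ} (layerArtin p 𝔣 s 𝔞)⁻¹ ∈ Gal(K̄/K̃_n)` — the pin (A1) together with its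
non-vacuity. [cite: JohnsonLeungKings2011, §5.1 (arXiv p0014:L12–14)] [cite: NeukirchANT1999, Ch. VI §6 Cor. (6.6)] -/
theorem exists_artin_exponents_and_level [IsTotallyComplex K] (h𝔣 : 𝔣 ≠ ⊥) {κ₁ κ₂ : ZpExtension K p}
    {γ₁ γ₂ : absoluteGaloisGroup K} (hγ : ZpExtension.IsTopGeneratorPair κ₁ κ₂ γ₁ γ₂) :
    ∃ artin₁ artin₂ : AuxIdeals p 𝔣 → ℤ_[p], ∀ (a : AuxIdeals p 𝔣) (n : ℕ),
      (∃ s₀ : ℕ, ∀ s : ℕ, s₀ ≤ s → katoLevelSubgroup p 𝔣 s ≤ pairLayerSubgroup κ₁ κ₂ n →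
        γ₁ ^ (PadicInt.toZModPow n (artin₁ a)).val * γ₂ ^ (PadicInt.toZModPow n (artin₂ a)).val *
            (layerArtin p 𝔣 s a.1)⁻¹ ∈ pairLayerSubgroup κ₁ κ₂ n) ∧
      (∃ s : ℕ, katoLevelSubgroup p 𝔣 s ≤ pairLayerSubgroup κ₁ κ₂ n ∧
        γ₁ ^ (PadicInt.toZModPow n (artin₁ a)).val * γ₂ ^ (PadicInt.toZModPow n (artin₂ a)).val *
            (layerArtin p 𝔣 s a.1)⁻¹ ∈ pairLayerSubgroup κ₁ κ₂ n) := by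
  obtain ⟨x₁, x₂, h⟩ := exists_artin_exponents (p := p) h𝔣 hγ
  refine ⟨x₁, x₂, fun a n ↦ ⟨h a n, ?_⟩⟩
  obtain ⟨s₀, hs₀⟩ := h a n
  obtain ⟨s₁, hs₁⟩ := exists_katoLevelSubgroup_le_pairLayerSubgroup 𝔣 h𝔣 κ₁ κ₂ n
  have hle : katoLevelSubgroup p 𝔣 (max s₀ s₁) ≤ pairLayerSubgroup κ₁ κ₂ n :=
    (katoLevelSubgroup_antitone p 𝔣 h𝔣 (le_max_right s₀ s₁)).trans hs₁
  exact ⟨max s₀ s₁, hle, hs₀ _ (le_max_left _ _) hle⟩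

end JohnsonLeungKings2011

end Literature.NumberTheory.ComplexMultiplication.EllipticUnits
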